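import Mathlib
import Summits.Ventures.PercRepro2.HCov
import Summits.Ventures.PercRepro2.Graph
import Summits.Ventures.PercRepro2.RestrictClosure
import Summits.Ventures.PercRepro2.RECMReduction
import Summits.Ventures.PercRepro2.CCWReduced
import Summits.Ventures.PercRepro2.A3Reduction
import Summits.Ventures.PercRepro2.CutVertexPaths
import Summits.Ventures.PercRepro2.GcSkelRules
import Summits.Ventures.PercRepro2.GcSkelReduction
import Summits.Ventures.PercRepro2.GcSkelReductionS
import Summits.Ventures.PercRepro2.GcSkelReductionC
import Summits.Ventures.PercRepro2.GcSkelReductionR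
import Summits.Ventures.PercRepro2.GcSkelReductionN
import Summits.Ventures.PercRepro2.GcSkelReductionB
import Summits.Ventures.PercRepro2.GcSkelReductionSeven
import Summits.Ventures.PercRepro2.GcSkelReductionP
import Summits.Ventures.PercRepro2.GcSkelReductionI
import Summits.Ventures.PercRepro2.GcSkelCutShape
import Summits.Ventures.PercRepro2.GcSkelTwoConnected
import Summits.Ventures.PercRepro2.GcSkelWhitney

/-!
# The weighted residual, characterised without cut vertices — the `2 + 3` clause and the
equivalence (blind cell PercRepro2, typer-1 g53)

`twoThree` from `WhitneyOff` (`pair_contra`: a pair of distinct marks on the left or at the cut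
vertex contradicts a mark among `o, a₁, a₂, b` on the right — a mark other than `a₃` on the left is
impossible, and `a₃` on the left forces an unmarked cut vertex; `twoThree_of_whitney`: the ten
disjuncts of `WRed.TwoThree`), and **`wredI_iff_wredW`**: for five distinct marks
`WReducedI ↔ WReducedW` — the residual of the reduction lane as a list of finite checks
(simplicity, degrees, leaf attachments, the class predicates, the no-isolated-mark clauses, and the
connectivity of `G − v` for every `v`).
-/

namespace Summit.Ventures.PercRepro2

open CovForm RECM CutVertexM9 SepPair

namespace WRed

section CutClauses

variable {V : Type*} {E : Type*} [Fintype E] [DecidableEq V]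
variable {ends : E → Sym2 V} {side : E → Bool} {L : Set V} {v : V} {Rt : Set V} {o a₁ a₂ a₃ b : V}

/-- **A pair of distinct marks on the left or at `v` contradicts a mark among `o, a₁, a₂, b` on the
right.** -/
lemma pair_contra (h : WReducedW ends o a₁ a₂ a₃ b) (h12 : a₁ ≠ a₂) (h13 : a₁ ≠ a₃)
    (h23 : a₂ ≠ a₃) (ho3 : o ≠ a₃) (hb3 : b ≠ a₃) (hcut : CutVertex ends side L v Rt) {m : V}
    (hm : m = a₁ ∨ m = a₂ ∨ m = o ∨ m = b) (hmR : m ∈ Rt) {x y : V}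
    (hxm : x = a₁ ∨ x = a₂ ∨ x = o ∨ x = b ∨ x = a₃) (hym : y = a₁ ∨ y = a₂ ∨ y = o ∨ y = b ∨ y = a₃)
    (hxy : x ≠ y) (hx : x ∈ L ∨ x = v) (hy : y ∈ L ∨ y = v) : False := by
  -- a mark on the left other than `a₃` is impossible
  have hL : ∀ z, (z = a₁ ∨ z = a₂ ∨ z = o ∨ z = b) → z ∈ L → False := fun z hz hzL =>
    not_left_of_wredW h h12 h13 h23 ho3 hb3 hcut hm hmR (ne_a3_of_mark h12 h13 h23 ho3 hb3 hz)
      (mark_edge_of_wredW h hz) hzL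
  -- `a₃` on the left forces an unmarked `v`
  have hA : a₃ ∈ L → Unmarked o a₁ a₂ a₃ b v := by
    intro h3L
    obtain ⟨e, z, he, hz⟩ := exists_a3_edge_of_not_a3ToMarks h.notR3
    have hse : side e = true :=
      side_eq_true_of_mem_left hcut h3L (by rw [he]; exact Sym2.mem_mk_left _ _)
    rcases hcut.left e hse z (by rw [he]; exact Sym2.mem_mk_right _ _) with hzL | hzv
    · exfalso
      exact not_left_of_wredW h h12 h13 h23 ho3 hb3 hcut hm hmR hz.2.2.2.1
        ⟨e, by rw [he]; exact Sym2.mem_mk_right _ _, by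
          rw [he, Sym2.mk_isDiag_iff]; exact fun h' => hz.2.2.2.1 h'.symm⟩ hzL
    · exact hzv ▸ hz
  -- a mark at `v` is not unmarked
  have hV : ∀ z, (z = a₁ ∨ z = a₂ ∨ z = o ∨ z = b ∨ z = a₃) → z = v →
      Unmarked o a₁ a₂ a₃ b v → False := by
    intro z hz hzv hu
    subst hzv
    rcases hz with rfl | rfl | rfl | rfl | rfl
    · exact hu.2.1 rfl
    · exact hu.2.2.1 rfl
    · exact hu.1 rfl
    · exact hu.2.2.2.2 rfl
    · exact hu.2.2.2.1 rfl
  rcases hx with hxL | hxv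
  · rcases hxm with hxm | hxm | hxm | hxm | rfl
    · exact hL x (Or.inl hxm) hxL
    · exact hL x (Or.inr (Or.inl hxm)) hxL
    · exact hL x (Or.inr (Or.inr (Or.inl hxm))) hxL
    · exact hL x (Or.inr (Or.inr (Or.inr hxm))) hxL
    · -- `x = a₃` on the left: `y` is on the left (impossible) or at the unmarked `v`
      rcases hy with hyL | hyv
      · rcases hym with hym | hym | hym | hym | rfl
        · exact hL y (Or.inl hym) hyL
        · exact hL y (Or.inr (Or.inl hym)) hyL
        · exact hL y (Or.inr (Or.inr (Or.inl hym))) hyL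
        · exact hL y (Or.inr (Or.inr (Or.inr hym))) hyL
        · exact hxy rfl
      · exact hV y hym hyv (hA hxL)
  · rcases hy with hyL | hyv
    · rcases hym with hym | hym | hym | hym | rfl
      · exact hL y (Or.inl hym) hyL
      · exact hL y (Or.inr (Or.inl hym)) hyL
      · exact hL y (Or.inr (Or.inr (Or.inl hym))) hyL
      · exact hL y (Or.inr (Or.inr (Or.inr hym))) hyL
      · exact hV x hxm hxv (hA hyL)
    · exact hxy (hxv.trans hyv.symm)

/-- **`twoThree` from `WhitneyOff`**: no `2 + 3` split of the marks at a cut vertex. -/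
lemma twoThree_of_whitney (h : WReducedW ends o a₁ a₂ a₃ b) (h12 : a₁ ≠ a₂) (h13 : a₁ ≠ a₃)
    (h23 : a₂ ≠ a₃) (ho1 : o ≠ a₁) (ho2 : o ≠ a₂) (ho3 : o ≠ a₃) (hob : o ≠ b) (hb1 : b ≠ a₁)
    (hb2 : b ≠ a₂) (hb3 : b ≠ a₃) (hcut : CutVertex ends side L v Rt) :
    ¬ TwoThree L v Rt o a₁ a₂ a₃ b := by
  intro hT
  unfold TwoThree at hT
  rcases hT with ⟨hx, hy, hz1, -, hz3⟩ |
      ⟨hx, hy, hz1, hz2, -⟩ |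
      ⟨hx, hy, hz1, hz2, -⟩ |
      ⟨hx, hy, hz1, -, hz3⟩ |
      ⟨hx, hy, hz1, -, hz3⟩ |
      ⟨hx, hy, hz1, -, hz3⟩ |
      ⟨hx, hy, hz1, -, hz3⟩ |
      ⟨hx, hy, hz1, hz2, -⟩ |
      ⟨hx, hy, hz1, hz2, -⟩ |
      ⟨hx, hy, hz1, hz2, -⟩
  · -- {a₁, a₂} | o, a₃, b
    rcases mark_right_of_two hz1 hz3 hob with hR | hR
    · exact pair_contra h h12 h13 h23 ho3 hb3 hcut
        (Or.inr (Or.inr (Or.inl rfl))) hR (Or.inl rfl) (Or.inr (Or.inl rfl)) h12 hx hy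
    · exact pair_contra h h12 h13 h23 ho3 hb3 hcut
        (Or.inr (Or.inr (Or.inr rfl))) hR (Or.inl rfl) (Or.inr (Or.inl rfl)) h12 hx hy
  · -- {a₁, a₃} | o, a₂, b
    rcases mark_right_of_two hz1 hz2 ho2 with hR | hR
    · exact pair_contra h h12 h13 h23 ho3 hb3 hcut
        (Or.inr (Or.inr (Or.inl rfl))) hR (Or.inl rfl) (Or.inr (Or.inr (Or.inr (Or.inr rfl)))) h13 hx hy
    · exact pair_contra h h12 h13 h23 ho3 hb3 hcut
        (Or.inr (Or.inl rfl)) hR (Or.inl rfl) (Or.inr (Or.inr (Or.inr (Or.inr rfl)))) h13 hx hy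
  · -- {a₂, a₃} | o, a₁, b
    rcases mark_right_of_two hz1 hz2 ho1 with hR | hR
    · exact pair_contra h h12 h13 h23 ho3 hb3 hcut
        (Or.inr (Or.inr (Or.inl rfl))) hR (Or.inr (Or.inl rfl)) (Or.inr (Or.inr (Or.inr (Or.inr rfl)))) h23 hx hy
    · exact pair_contra h h12 h13 h23 ho3 hb3 hcut
        (Or.inl rfl) hR (Or.inr (Or.inl rfl)) (Or.inr (Or.inr (Or.inr (Or.inr rfl)))) h23 hx hy
  · -- {a₁, o} | a₂, a₃, b
    rcases mark_right_of_two hz1 hz3 hb2.symm with hR | hR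
    · exact pair_contra h h12 h13 h23 ho3 hb3 hcut
        (Or.inr (Or.inl rfl)) hR (Or.inl rfl) (Or.inr (Or.inr (Or.inl rfl))) ho1.symm hx hy
    · exact pair_contra h h12 h13 h23 ho3 hb3 hcut
        (Or.inr (Or.inr (Or.inr rfl))) hR (Or.inl rfl) (Or.inr (Or.inr (Or.inl rfl))) ho1.symm hx hy
  · -- {a₂, o} | a₁, a₃, b
    rcases mark_right_of_two hz1 hz3 hb1.symm with hR | hR
    · exact pair_contra h h12 h13 h23 ho3 hb3 hcut
        (Or.inl rfl) hR (Or.inr (Or.inl rfl)) (Or.inr (Or.inr (Or.inl rfl))) ho2.symm hx hy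
    · exact pair_contra h h12 h13 h23 ho3 hb3 hcut
        (Or.inr (Or.inr (Or.inr rfl))) hR (Or.inr (Or.inl rfl)) (Or.inr (Or.inr (Or.inl rfl))) ho2.symm hx hy
  · -- {a₁, b} | a₂, a₃, o
    rcases mark_right_of_two hz1 hz3 ho2.symm with hR | hR
    · exact pair_contra h h12 h13 h23 ho3 hb3 hcut
        (Or.inr (Or.inl rfl)) hR (Or.inl rfl) (Or.inr (Or.inr (Or.inr (Or.inl rfl)))) hb1.symm hx hy
    · exact pair_contra h h12 h13 h23 ho3 hb3 hcut
        (Or.inr (Or.inr (Or.inl rfl))) hR (Or.inl rfl) (Or.inr (Or.inr (Or.inr (Or.inl rfl)))) hb1.symm hx hy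
  · -- {a₂, b} | a₁, a₃, o
    rcases mark_right_of_two hz1 hz3 ho1.symm with hR | hR
    · exact pair_contra h h12 h13 h23 ho3 hb3 hcut
        (Or.inl rfl) hR (Or.inr (Or.inl rfl)) (Or.inr (Or.inr (Or.inr (Or.inl rfl)))) hb2.symm hx hy
    · exact pair_contra h h12 h13 h23 ho3 hb3 hcut
        (Or.inr (Or.inr (Or.inl rfl))) hR (Or.inr (Or.inl rfl)) (Or.inr (Or.inr (Or.inr (Or.inl rfl)))) hb2.symm hx hy
  · -- {o, a₃} | a₁, a₂, b
    rcases mark_right_of_two hz1 hz2 h12 with hR | hR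
    · exact pair_contra h h12 h13 h23 ho3 hb3 hcut
        (Or.inl rfl) hR (Or.inr (Or.inr (Or.inl rfl))) (Or.inr (Or.inr (Or.inr (Or.inr rfl)))) ho3 hx hy
    · exact pair_contra h h12 h13 h23 ho3 hb3 hcut
        (Or.inr (Or.inl rfl)) hR (Or.inr (Or.inr (Or.inl rfl))) (Or.inr (Or.inr (Or.inr (Or.inr rfl)))) ho3 hx hy
  · -- {a₃, b} | a₁, a₂, o
    rcases mark_right_of_two hz1 hz2 h12 with hR | hR
    · exact pair_contra h h12 h13 h23 ho3 hb3 hcut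
        (Or.inl rfl) hR (Or.inr (Or.inr (Or.inr (Or.inr rfl)))) (Or.inr (Or.inr (Or.inr (Or.inl rfl)))) hb3.symm hx hy
    · exact pair_contra h h12 h13 h23 ho3 hb3 hcut
        (Or.inr (Or.inl rfl)) hR (Or.inr (Or.inr (Or.inr (Or.inr rfl)))) (Or.inr (Or.inr (Or.inr (Or.inl rfl)))) hb3.symm hx hy
  · -- {o, b} | a₁, a₂, a₃
    rcases mark_right_of_two hz1 hz2 h12 with hR | hR
    · exact pair_contra h h12 h13 h23 ho3 hb3 hcut
        (Or.inl rfl) hR (Or.inr (Or.inr (Or.inl rfl))) (Or.inr (Or.inr (Or.inr (Or.inl rfl)))) hob hx hy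
    · exact pair_contra h h12 h13 h23 ho3 hb3 hcut
        (Or.inr (Or.inl rfl)) hR (Or.inr (Or.inr (Or.inl rfl))) (Or.inr (Or.inr (Or.inr (Or.inl rfl)))) hob hx hy

end CutClauses

section Main

variable {V : Type*} {E : Type*} [Fintype E] [DecidableEq V]
variable {ends : E → Sym2 V} {o a₁ a₂ a₃ b : V}

/-- **The residual satisfies `WhitneyOff`**: `WReducedI → WReducedW`. -/
theorem wredW_of_wredI (h : WReducedI ends o a₁ a₂ a₃ b) (h12 : a₁ ≠ a₂) (h13 : a₁ ≠ a₃)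
    (h23 : a₂ ≠ a₃) (ho1 : o ≠ a₁) (ho2 : o ≠ a₂) (ho3 : o ≠ a₃) (hob : o ≠ b) (hb1 : b ≠ a₁)
    (hb2 : b ≠ a₂) (hb3 : b ≠ a₃) : WReducedW ends o a₁ a₂ a₃ b where
  simple := h.simple
  unmarked := h.unmarked
  deg_o := h.deg_o
  deg_b := h.deg_b
  deg_a1 := h.deg_a1
  deg_a2 := h.deg_a2
  leaf_a3 := h.leaf_a3
  notR := h.notR
  notR3 := h.notR3
  noPocket := h.noPocket
  sep2 := h.sep2
  sep3 := h.sep3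
  sep3' := h.sep3'
  noNecklace := h.noNecklace
  notFive := h.notFive
  notSix := h.notSix
  notSeven := h.notSeven
  notSeven' := h.notSeven'
  notIso_a1 := h.notIso_a1
  notIso_a2 := h.notIso_a2
  notIso_o := h.notIso_o
  notIso_b := h.notIso_b
  whitney := fun _ _ _ hxv hyv hx3 hy3 hx hy =>
    conn_sepConfig_of_wredI h h12 h13 h23 ho1 ho2 ho3 hob hb1 hb2 hb3 hxv hyv hx3 hy3 hx hy

/-- **`WhitneyOff` gives the cut-vertex clauses**: `WReducedW → WReducedI`. -/
theorem wredI_of_wredW (h : WReducedW ends o a₁ a₂ a₃ b) (h12 : a₁ ≠ a₂) (h13 : a₁ ≠ a₃)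
    (h23 : a₂ ≠ a₃) (ho1 : o ≠ a₁) (ho2 : o ≠ a₂) (ho3 : o ≠ a₃) (hob : o ≠ b) (hb1 : b ≠ a₁)
    (hb2 : b ≠ a₂) (hb3 : b ≠ a₃) : WReducedI ends o a₁ a₂ a₃ b :=
  ⟨⟨⟨⟨⟨⟨⟨⟨⟨h.simple, h.unmarked, h.deg_o, h.deg_b⟩, h.leaf_a3,
      fun _ _ _ _ hd => absurd hd h.deg_a1, fun _ _ _ _ hd => absurd hd h.deg_a2⟩,
      fun _ _ _ _ g hcut hM hg => prune_of_whitney h h12 h13 h23 ho3 hb3 hcut g hM hg,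
      fun _ _ _ _ w hcut hw hM =>
        oneFar_of_whitney h h12 h13 h23 ho1 ho2 ho3 hb1 hb2 hb3 hcut w hw hM,
      fun _ _ _ _ hcut => twoThree_of_whitney h h12 h13 h23 ho1 ho2 ho3 hob hb1 hb2 hb3 hcut⟩,
      h.notR, h.notR3, h.noPocket, h.sep2, h.sep3, h.sep3'⟩, h.noNecklace⟩, h.notFive, h.notSix⟩,
      h.notSeven, h.notSeven'⟩, h.deg_a1, h.deg_a2⟩, h.notIso_a1, h.notIso_a2, h.notIso_o,
    h.notIso_b⟩

/-- **THE RESIDUAL WITHOUT CUT-VERTEX CLAUSES**: for five distinct marks, `WReducedI ↔ WReducedW` —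
the cut-vertex clauses of the residual are exactly two-connectivity off `a₃`. -/
theorem wredI_iff_wredW (h12 : a₁ ≠ a₂) (h13 : a₁ ≠ a₃) (h23 : a₂ ≠ a₃) (ho1 : o ≠ a₁)
    (ho2 : o ≠ a₂) (ho3 : o ≠ a₃) (hob : o ≠ b) (hb1 : b ≠ a₁) (hb2 : b ≠ a₂) (hb3 : b ≠ a₃) :
    WReducedI ends o a₁ a₂ a₃ b ↔ WReducedW ends o a₁ a₂ a₃ b :=
  ⟨fun h => wredW_of_wredI h h12 h13 h23 ho1 ho2 ho3 hob hb1 hb2 hb3,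
   fun h => wredI_of_wredW h h12 h13 h23 ho1 ho2 ho3 hob hb1 hb2 hb3⟩

end Main

end WRed

end Summit.Ventures.PercRepro2
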